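import Literature.NumberTheory.Automorphic.UnitaryCurveCohCotangentFormsContinuous
import Literature.NumberTheory.Automorphic.UnitaryGroupArchSection
import Literature.AlgebraicGeometry.ShimuraVarieties.UnitaryCurveConeHolomorphyOfCR
import Literature.AlgebraicGeometry.ShimuraVarieties.UnitaryCurveConeExtension
import Summits.HodgeConjecture.HodgeConjecture.Theorems.H413SpectrumJunction
import HarnessLib

/-!
# FLOOR-0 P5 (K-lane), sub-line `F0_P5TP2SpectralProjection` — STUB (S₂), file 1∕2: the probe family `γ = exp ∘ X` in `U(σ_{w₁}H)(ℂ)` and the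
# POINTWISE data of a cone-holomorphic cotangent form of `U(H)`, `H ∈ M₂(L)`

Cell hodgecm-mathlib, FLOOR 0, crux item HLiu418 = stmt-HodgeConjecture-24832; sub-line `Cruxes/HLiu418/Lines/F0_P5TP2SpectralProjection.lean`
(A-p14 (g16) skeleton v0 `ce659ab5fe57535c` ≡ v1 on statements), registered-shape stub `stub_S₂ : StubS₂CotFormL2Data` (:242); seat F0P2-p02 (g2).
PROOF lane (theorems only — no definition, no instance, no notation, no named fact, no `sorry`), `--supports stmt-HodgeConjecture-24832 --as helper`.
This file is the pointwise half of the (S₂) closer `Theorems/F0P5TP2StubS.lean :: stubS₂_holds` (file 2∕2, the `L²` fields and the head).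

## Contents
* §1 the `𝔭`-probe family `γ : ℂ → U := U(σ_{w₁}H)(ℂ)` with `γ z = exp (X z)`, `X` real-linear: `γ(−z) = (γ z)⁻¹` (★ `UnitaryCurveCone.exp_mul_exp_neg`)
  and `γ` continuous; `U` is locally compact and second countable (closed subgroup of `GL₂(ℂ)`, ★ `isClosed_archLocal`) — the two instances the
  `L²`-side Fubini ∕ differentiation lemmas of ★ `AutomorphicFormsL2OrbitalSmoothingChart` want.
* §2 the pointwise clauses of `f ∈ holCotForms₂ 𝔣` read off ★ `mem_holCotForms₂_iff`: left `U(H)(L⁺)`-invariance as `quotientSubgroup`-invariance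
  (★ `SpectrumJunction.quotientSubgroup_adelicGroupData`), right `K_c`-invariance, ONE open `K_f` fixing `f` (★ `mem_smoothFun₂_iff`), the
  cone-holomorphic slice `Φ_x(u) = f(x · sec u)` at every base point and its continuity on `U` (★ `IsConeHol.continuous_comp_archLocal`), and the
  TYPE LAW `f(x · sec κ) = (a k⁻¹) · f x` for `κ ∈ U` with frame coordinates `(k, a, d)` (the cone law of `Φ_x` at `g = 1`).

HC_CM is proved only modulo the printed citations until rung 0 closes; this file uses no printed citation as a hypothesis.

## References
* [Borel1997] A. Borel, *Automorphic forms on SL₂(ℝ)*, Cambridge Tracts 130 (1997), §2.13, §5.13–§5.14.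
* [BorelJacquet1979] A. Borel, H. Jacquet, *Automorphic forms and automorphic representations*, PSPM 33.1 (1979), §4.2.
-/

set_option autoImplicit false

-- the mandated namespace has the single-problem summit's repeated segment (`HodgeConjecture.HodgeConjecture`)
set_option linter.dupNamespace false

noncomputable section

namespace Summit.HodgeConjecture.HodgeConjecture.Cruxes.HLiu418.F0P5TP2StubSPointwise

open scoped Matrix ComplexOrder ContDiff Topology
open NumberField NumberField.InfinitePlace MeasureTheory Filter Set
open Literature.NumberTheory.Automorphic Literature.NumberTheory.Automorphic.UnitaryGroup
open Literature.NumberTheory.Automorphic.UnitaryCurveForms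
open Literature.AlgebraicGeometry.ShimuraVarieties
open Summit.HodgeConjecture.HodgeConjecture.Cruxes.H413.SpectrumJunction

/-! ## §1 The probe family `γ = exp ∘ X` in `U(σ_{w₁}H)(ℂ)`: oddness and continuity; local compactness of `U` -/

section Probe

variable {L : Type} [Field L] [NumberField L] [IsCMField L] {ι : L →+* ℂ} {H : Matrix (Fin 2) (Fin 2) L}
  {X : ℂ →ₗ[ℝ] Matrix (Fin 2) (Fin 2) ℂ} {γ : ℂ → archLocal L 2 H (cmPlace L ι)}
  (hγ : ∀ z, ((γ z : GL (Fin 2) ℂ) : Matrix (Fin 2) (Fin 2) ℂ) = NormedSpace.exp (X z))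
include hγ

/-- `γ (−z) = (γ z)⁻¹` for `γ = exp ∘ X` with `X` real-linear (`exp (−Y) exp Y = 1`, ★ `UnitaryCurveCone.exp_mul_exp_neg`).
[cite: Borel1997, §5.14] -/
theorem probe_neg (z : ℂ) : γ (-z) = (γ z)⁻¹ := by
  refine eq_inv_of_mul_eq_one_left (Subtype.ext (Units.ext ?_))
  change ((γ (-z) : GL (Fin 2) ℂ) : Matrix (Fin 2) (Fin 2) ℂ) * ((γ z : GL (Fin 2) ℂ) : Matrix (Fin 2) (Fin 2) ℂ) = 1
  rw [hγ, hγ, map_neg]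
  exact (UnitaryCurveCone.exp_mul_exp_neg (X z)).2

/-- `γ = exp ∘ X` is continuous into `U(σ_{w₁}H)(ℂ)` (matrix exponential continuous; inverse branch `exp ∘ (−X)`), and odd: `γ(−z) = (γ z)⁻¹` — the two
chart hypotheses of ★ `AutomorphicFormsL2OrbitalSmoothingChart`, bundled. [cite: Borel1997, §5.14] -/
theorem continuous_probe_and_neg : Continuous γ ∧ ∀ z : ℂ, γ (-z) = (γ z)⁻¹ := by
  refine ⟨?_, probe_neg hγ⟩
  have hval : Continuous fun z => ((γ z : GL (Fin 2) ℂ) : Matrix (Fin 2) (Fin 2) ℂ) := by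
    have h : (fun z => ((γ z : GL (Fin 2) ℂ) : Matrix (Fin 2) (Fin 2) ℂ)) = fun z => NormedSpace.exp (X z) := funext hγ
    rw [h]
    open scoped Matrix.Norms.Operator in exact NormedSpace.exp_continuous.comp X.continuous_of_finiteDimensional
  have hinv : Continuous fun z => (((γ z : GL (Fin 2) ℂ)⁻¹ : GL (Fin 2) ℂ) : Matrix (Fin 2) (Fin 2) ℂ) := by
    have h : (fun z => (((γ z : GL (Fin 2) ℂ)⁻¹ : GL (Fin 2) ℂ) : Matrix (Fin 2) (Fin 2) ℂ)) =
        fun z => ((γ (-z) : GL (Fin 2) ℂ) : Matrix (Fin 2) (Fin 2) ℂ) := by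
      funext z
      rw [probe_neg hγ z]
      rfl
    rw [h]
    exact hval.comp continuous_neg
  have hGL : Continuous fun z => (γ z : GL (Fin 2) ℂ) := Units.continuous_iff.2 ⟨hval, hinv⟩
  exact continuous_induced_rng.2 hGL

omit hγ in
/-- `U(σ_{w₁}H)(ℂ)` is locally compact: a closed subgroup (★ `isClosed_archLocal`) of the locally compact `GL₂(ℂ)`. [cite: Borel1997, §2.13] -/
theorem locallyCompactSpace_archLocal : LocallyCompactSpace (archLocal L 2 H (cmPlace L ι)) := by
  haveI : LocallyCompactSpace (Matrix (Fin 2) (Fin 2) ℂ) := inferInstanceAs (LocallyCompactSpace (Fin 2 → Fin 2 → ℂ))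
  haveI : LocallyCompactSpace (GL (Fin 2) ℂ) :=
    open scoped Matrix.Norms.Operator in (Units.isOpenEmbedding_val (R := Matrix (Fin 2) (Fin 2) ℂ)).locallyCompactSpace
  exact (isClosed_archLocal L 2 H (cmPlace L ι)).isClosedEmbedding_subtypeVal.locallyCompactSpace

omit hγ in
/-- `U(σ_{w₁}H)(ℂ)` is second countable (a subspace of `GL₂(ℂ) ↪ M₂(ℂ) × M₂(ℂ)ᵐᵒᵖ`). [cite: Borel1997, §2.13] -/
theorem secondCountableTopology_archLocal : SecondCountableTopology (archLocal L 2 H (cmPlace L ι)) := by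
  haveI : SecondCountableTopology (Matrix (Fin 2) (Fin 2) ℂ) := inferInstanceAs (SecondCountableTopology (Fin 2 → Fin 2 → ℂ))
  haveI : SecondCountableTopology (Matrix (Fin 2) (Fin 2) ℂ)ᵐᵒᵖ := MulOpposite.opHomeomorph.symm.secondCountableTopology
  haveI : SecondCountableTopology (GL (Fin 2) ℂ) := Units.isEmbedding_embedProduct.secondCountableTopology
  exact TopologicalSpace.Subtype.secondCountableTopology _

end Probe

/-! ## §2 Pointwise data of a cone-holomorphic cotangent form -/

section Pointwise

variable {L : Type} [Field L] [NumberField L] [IsCMField L] {ι : L →+* ℂ} {H : Matrix (Fin 2) (Fin 2) L}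
  {𝔣 : ConeFrame L H (cmPlace L ι)}
  {f : (adelicGroupData (↥(maximalRealSubfield L)) L (IsCMField.complexConj L) 2 H).Adelic → ℂ}
  (hf : f ∈ holCotForms₂ (↥(maximalRealSubfield L)) L (IsCMField.complexConj L) H (IsCMField.complexConj_ne_one L)
    (UnitaryGroup.complexConj_smul_infinitePlace L) (cmPlace L ι) 𝔣)
include hf

/-- (L) as `quotientSubgroup`-invariance (`A_G · U(H)(L⁺) = U(H)(L⁺)`, ★ `SpectrumJunction.quotientSubgroup_adelicGroupData`). [cite: BorelJacquet1979, §4.2] -/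
theorem leftInv : ∀ γr ∈ (adelicGroupData (↥(maximalRealSubfield L)) L (IsCMField.complexConj L) 2 H).quotientSubgroup, ∀ x, f (γr * x) = f x := by
  intro γr hγr x
  rw [quotientSubgroup_adelicGroupData] at hγr
  obtain ⟨γ0, rfl⟩ := hγr
  exact ((mem_holCotForms₂_iff _ _ _ _ _ _ _ 𝔣 f).1 hf).1 γ0 x

/-- (Kc) right invariance under the compact archimedean factor away from `w₁`. [cite: BorelJacquet1979, §4.2] -/
theorem apply_mul_kc {k : (adelicGroupData (↥(maximalRealSubfield L)) L (IsCMField.complexConj L) 2 H).Adelic}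
    (hk : k ∈ ((archAt (↥(maximalRealSubfield L)) L (IsCMField.complexConj L) 2 H (cmPlace L ι)
      (UnitaryGroup.complexConj_smul_infinitePlace L (cmPlace L ι).1) (IsCMField.complexConj_ne_one L)).ker).map
        (archToAdelic (↥(maximalRealSubfield L)) L (IsCMField.complexConj L) 2 H)) (x) : f (x * k) = f x :=
  ((mem_holCotForms₂_iff _ _ _ _ _ _ _ 𝔣 f).1 hf).2.1 k hk x

/-- (Sm) ONE open `K_f ≤ U(H)(𝔸_{L⁺,f})` fixing `f`. [cite: BorelJacquet1979, §4.2] -/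
theorem exists_open_kf : ∃ Kf : Subgroup (finAdelic (↥(maximalRealSubfield L)) L (IsCMField.complexConj L) 2 H),
    IsOpen (Kf : Set (finAdelic (↥(maximalRealSubfield L)) L (IsCMField.complexConj L) 2 H)) ∧
      ∀ k ∈ Kf, ∀ x, f (x * finAdelicToAdelic (↥(maximalRealSubfield L)) L (IsCMField.complexConj L) 2 H k) = f x :=
  (mem_smoothFun₂_iff _ _ _ _ f).1 ((mem_holCotForms₂_iff _ _ _ _ _ _ _ 𝔣 f).1 hf).2.2.1

/-- (H) the cone-holomorphic slice at a base point. [cite: Borel1997, §5.14] -/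
theorem exists_slice (x : (adelicGroupData (↥(maximalRealSubfield L)) L (IsCMField.complexConj L) 2 H).Adelic) :
    ∃ Φ : Matrix (Fin 2) (Fin 2) ℂ → ℂ, IsConeHol 𝔣 Φ ∧ ∀ u : archLocal L 2 H (cmPlace L ι),
      Φ ((u : GL (Fin 2) ℂ) : Matrix (Fin 2) (Fin 2) ℂ) =
        f (x * adelicSingle (↥(maximalRealSubfield L)) L (IsCMField.complexConj L) 2 H (IsCMField.complexConj_ne_one L)
          (UnitaryGroup.complexConj_smul_infinitePlace L) (cmPlace L ι) u) :=
  ((mem_holCotForms₂_iff _ _ _ _ _ _ _ 𝔣 f).1 hf).2.2.2 x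

/-- The slice at `x` is continuous on `U(σ_{w₁}H)(ℂ)`. [cite: Borel1997, §5.14] -/
theorem continuous_slice (x : (adelicGroupData (↥(maximalRealSubfield L)) L (IsCMField.complexConj L) 2 H).Adelic) :
    Continuous fun u : archLocal L 2 H (cmPlace L ι) =>
      f (x * adelicSingle (↥(maximalRealSubfield L)) L (IsCMField.complexConj L) 2 H (IsCMField.complexConj_ne_one L)
        (UnitaryGroup.complexConj_smul_infinitePlace L) (cmPlace L ι) u) := by
  obtain ⟨Φ, hΦ, hΦf⟩ := exists_slice hf x
  exact (hΦ.continuous_comp_archLocal L H (cmPlace L ι)).congr fun u => hΦf u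

/-- **THE TYPE LAW at a base point**: `f (x · sec κ) = (a k⁻¹) · f x` for `κ ∈ U(σ_{w₁}H)(ℂ)` with frame coordinates `(k, a, d)` (cone law of the slice
at `g = 1`). [cite: Borel1997, §5.13–§5.14] -/
theorem apply_mul_sec_eq (κ : archLocal L 2 H (cmPlace L ι)) (a k d : ℂ) (hk : k ≠ 0)
    (hκv : ((κ : GL (Fin 2) ℂ) : Matrix (Fin 2) (Fin 2) ℂ) *ᵥ 𝔣.v₀ = k • 𝔣.v₀)
    (hκt : ((κ : GL (Fin 2) ℂ) : Matrix (Fin 2) (Fin 2) ℂ) *ᵥ 𝔣.t₀ = a • 𝔣.t₀ + d • 𝔣.v₀)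
    (x : (adelicGroupData (↥(maximalRealSubfield L)) L (IsCMField.complexConj L) 2 H).Adelic) :
    f (x * adelicSingle (↥(maximalRealSubfield L)) L (IsCMField.complexConj L) 2 H (IsCMField.complexConj_ne_one L)
        (UnitaryGroup.complexConj_smul_infinitePlace L) (cmPlace L ι) κ) = (a * k⁻¹) * f x := by
  obtain ⟨Φ, hΦ, hΦf⟩ := exists_slice hf x
  have h1 : f x = Φ 1 := by
    have := hΦf 1
    rw [map_one, mul_one] at this
    rw [← this]
    rfl
  rw [← hΦf κ, h1]
  have hlaw := hΦ.2 1 ((κ : GL (Fin 2) ℂ) : Matrix (Fin 2) (Fin 2) ℂ) a k d isUnit_one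
    (by rw [Matrix.one_mulVec]; exact 𝔣.v₀_mem) hk hκv hκt
  rwa [one_mul] at hlaw

end Pointwise

end Summit.HodgeConjecture.HodgeConjecture.Cruxes.HLiu418.F0P5TP2StubSPointwise

end
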